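import Summits.ABC.IUTFork.LDHGenuinePerImageSufficiencyRamifiedRat
import HarnessLib

/-!
# The fork at [IUTchIII] Corollary 3.12, L-DH level, READING (P): the Step (ii) different bound with PER-PLACE
# ramification weights (abc-iut cell, crux ThetaPartII = stmt-ABC-19678; row «C:PERIMAGE-DIFFSHARP», part 1 of 3)

Record-only PROOF file (D-0012) of the abc-iut cell (WAVE-3 discharge seat abc-iut-c312-d1, gen 9). TAKES NO SIDE on
[IUTchIII] Cor. 3.12. Sequel to this seat's `LDHGenuinePerImageSufficiencyRamified(Rat)` (p467927 / p470192) and to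
abc-iut-s2-p4's `LDHGenuinePerImageUnconditional` (p471287). Those derive `T.Cor312PerImageOf` at a genuine Θ-volume datum
`T` of `(λ, l)` from `κ_l·log q^{∤2l}(λ) ≤ ((l+5)/4 − d_mod)·log(𝔡^K) + ((l+5)/4)·log π` (abc-iut-c312-d1 gen 7,
`GenuineContent.cor312PerImageOf_of_le_mul_ndeg`) together with a Step (ii) lower bound for `log(𝔡^K)` which reads the
ramification of `K = F(E_F[l])` through ONE uniform index `m` over a set `Sₓ` (plus `l` at the bad places). HERE the weight
becomes a FUNCTION of the place, so that every constraint on the ramification of `K` the tree proves at a genuine datum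
(`√−1 ∈ F` — abc-iut-E-t47's `two_dvd_ramificationIdx_of_sq_eq_neg_one` —, `μ₃₀ ⊂ F`, the `30`-th root of the Tate parameter,
`μ_l ⊂ K`; parts 2–3, `LDHGenuinePerImageRamificationRat`, `LDHGenuinePerImageSharpRat`) can be fed in at once:

* §1 `GenEll.cond_above_le_cond_weighted` — `(1/[L:ℚ])·Σ_{v∈S}Σ_{w∣v} log N(w) ≤ (1/[K:ℚ])·Σ_{v∈S} (1/m_v)·log N(v)` when every
  place of `L` over `v ∈ S` has `e(w∣v) ≥ m_v ≥ 1` (abc-iut-S4's `cond_above_le_cond_div_of_le_ramificationIdx` is the constant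
  weight; fundamental identity `Σ_w e_w f_w = [L:K]`);
* §2 **`Cor22.ThetaVolumeDatumAt.ndeg_differentDivisor_ge_weighted`** — for any finite set `S` of places of `F_tpd` and weights
  `m_v ≥ 1` with `m_v ≤ e(w∣v)` for every place `w` of the datum's `K` over `v ∈ S`:
  `log(𝔡^K) ≥ log-diff(λ) + (1/[F_tpd:ℚ])·Σ_{v∈S} (1 − 1/m_v)·log N(v)` ([GenEll] Prop. 1.7 (i)); and the sufficiency
  **`cor312PerImageOf_of_le_weighted`**: `κ_l·log q^{∤2l}(λ) ≤ ((l+5)/4 − d_mod)·(log-diff(λ) + (1/[F_tpd:ℚ])·Σ_{v∈S}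
  (1 − 1/m_v)·log N(v)) + ((l+5)/4)·log π ⟹ T.Cor312PerImageOf`. The bad places `𝕍^bad_mod` are NOT treated separately — they
  are members of `S` with their own weights (`l·(30/gcd(30,e_p))·…` in part 3).

Classical algebraic number theory around the cell's typed objects; nothing here asserts the existence of Θ-data, Cor. 3.12 in
general or in print's reading, or abc; proved-as-typed ≠ in print. [cite: Mochizuki2012, IUTchIII Cor. 3.12 p. 173–174;
IUTchIV Thm. 1.10 Step (ii) p. 24, Step (v) p. 27–29] [cite: MochizukiGenEll2010, Prop. 1.7 (i) p. 9–10]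
[cite: NeukirchANT1999, Ch. I §8 Prop. (8.2), Ch. II Prop. (6.8)] [claim: Mochizuki2012, status: disputed] for every IUT
quotation. PROOF-ONLY: no definitions, no new `Prop`.
-/

noncomputable section

open NumberField IsDedekindDomain Ideal Module

/-! ## 1. Conductors in a tower with per-place ramification weights -/

namespace Literature.NumberTheory.DiophantineGeometry.GenEll

variable (K L : Type) [Field K] [NumberField K] [Field L] [NumberField L] [Algebra K L]

/-- **`(1/[L:ℚ])·Σ_{v∈S}Σ_{w∣v} log N(w) ≤ (1/[K:ℚ])·Σ_{v∈S} (1/m_v)·log N(v)`** when every place of `L` over `v ∈ S` has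
ramification index `≥ m_v ≥ 1` over `K` (a weight PER PLACE): `m_v·Σ_{w∣v} f_w ≤ Σ_w e_w f_w = [L:K]` (fundamental identity,
Mathlib `Ideal.sum_ramification_inertia`) and `log N(w) = f_w·log N(v)`. The constant weight is abc-iut-S4's
`cond_above_le_cond_div_of_le_ramificationIdx`. [cite: MochizukiGenEll2010, Prop. 1.7 (i) p. 9–10]
[cite: NeukirchANT1999, Ch. I §8 Prop. (8.2)] -/
theorem cond_above_le_cond_weighted (S : Finset (HeightOneSpectrum (𝓞 K))) (m : HeightOneSpectrum (𝓞 K) → ℕ)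
    (hm : ∀ v ∈ S, 0 < m v)
    (hram : ∀ v ∈ S, ∀ w ∈ IsDedekindDomain.primesOverFinset v.asIdeal (𝓞 L), m v ≤ ramificationIdx' v.asIdeal w) :
    (finrank ℚ L : ℝ)⁻¹ * ∑ v ∈ S, ∑ w ∈ IsDedekindDomain.primesOverFinset v.asIdeal (𝓞 L),
        Real.log (absNorm w : ℝ) ≤
      (finrank ℚ K : ℝ)⁻¹ * ∑ v ∈ S, ((m v : ℝ)⁻¹ * Real.log (absNorm v.asIdeal : ℝ)) := by
  have hKpos : (0 : ℝ) < finrank ℚ K := by exact_mod_cast finrank_pos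
  have hKL : (0 : ℝ) < finrank K L := by exact_mod_cast finrank_pos
  have htower : (finrank ℚ L : ℝ) = finrank ℚ K * finrank K L := by
    exact_mod_cast (finrank_mul_finrank ℚ K L).symm
  -- per prime: `Σ_{w∣v} log N(w) ≤ (1/m_v)·[L:K]·log N(v)`
  have hv : ∀ v ∈ S, ∑ w ∈ IsDedekindDomain.primesOverFinset v.asIdeal (𝓞 L),
      Real.log (absNorm w : ℝ) ≤ (m v : ℝ)⁻¹ * ((finrank K L : ℝ) * Real.log (absNorm v.asIdeal : ℝ)) := by
    intro v hvS
    haveI := v.isMaximal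
    have hm0 : (0 : ℝ) < m v := by exact_mod_cast hm v hvS
    have hcast : (finrank K L : ℝ) = ∑ w ∈ IsDedekindDomain.primesOverFinset v.asIdeal (𝓞 L),
        (ramificationIdx' v.asIdeal w : ℝ) * (inertiaDeg' v.asIdeal w : ℝ) := by
      rw [← Ideal.sum_ramification_inertia (R := 𝓞 K) (𝓞 L) K L v.ne_bot]; push_cast; rfl
    have hlogv : 0 ≤ Real.log (absNorm v.asIdeal : ℝ) := by
      have h1 : (1 : ℝ) ≤ (absNorm v.asIdeal : ℕ) := by
        exact_mod_cast Nat.one_le_iff_ne_zero.mpr (by rw [Ne, Ideal.absNorm_eq_zero_iff]; exact v.ne_bot)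
      exact Real.log_nonneg h1
    rw [le_inv_mul_iff₀ hm0, hcast, Finset.mul_sum, Finset.sum_mul]
    refine Finset.sum_le_sum fun w hw => ?_
    rw [log_absNorm_eq_inertiaDeg_mul K L v.ne_bot hw, ← mul_assoc]
    refine mul_le_mul_of_nonneg_right ?_ hlogv
    have he : (m v : ℝ) ≤ ramificationIdx' v.asIdeal w := by exact_mod_cast hram v hvS w hw
    have hf : (0 : ℝ) ≤ inertiaDeg' v.asIdeal w := Nat.cast_nonneg _
    exact mul_le_mul_of_nonneg_right he hf
  have hsum : ∑ v ∈ S, ∑ w ∈ IsDedekindDomain.primesOverFinset v.asIdeal (𝓞 L), Real.log (absNorm w : ℝ) ≤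
      (finrank K L : ℝ) * ∑ v ∈ S, ((m v : ℝ)⁻¹ * Real.log (absNorm v.asIdeal : ℝ)) := by
    rw [Finset.mul_sum]
    refine Finset.sum_le_sum fun v hvS => ?_
    have h := hv v hvS
    rw [← mul_assoc, mul_comm ((m v : ℝ)⁻¹), mul_assoc] at h
    exact h
  have hL0 : 0 ≤ (finrank ℚ L : ℝ)⁻¹ := inv_nonneg.mpr (Nat.cast_nonneg _)
  have h2 := mul_le_mul_of_nonneg_left hsum hL0
  refine h2.trans (le_of_eq ?_)
  rw [htower, mul_inv, mul_assoc, ← mul_assoc ((finrank K L : ℝ)⁻¹), inv_mul_cancel₀ hKL.ne', one_mul]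

end Literature.NumberTheory.DiophantineGeometry.GenEll

/-! ## 2. The weighted Step (ii) lower bound and the weighted sufficiency at a genuine datum -/

namespace Literature.IUT.LogVolume.Cor22

open Literature.NumberTheory.DiophantineGeometry.GenEll Summit.ABC.IUTFork Literature.IUT.HodgeTheaters

namespace ThetaVolumeDatumAt

variable {P : NFPoint} {l : ℕ} (T : ThetaVolumeDatumAt P l)

/-- **STEP (ii) LOWER BOUND WITH PER-PLACE WEIGHTS**: for a finite set `S` of places of `F_tpd` and weights `m_v ≥ 1` such that
every place `w` of the datum's `K` over `v ∈ S` has ramification index `e(w∣v) ≥ m_v`: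
`log(𝔡^K) ≥ log-diff(λ) + (1/[F_tpd:ℚ])·Σ_{v∈S} (1 − 1/m_v)·log N(v)` — [GenEll] Prop. 1.7 (i)
(`cond_sub_cond_le_logdisc_sub_logdisc` with `T` = the places over `S`) and §1. The bad places `𝕍^bad_mod` are NOT treated
separately: they may be members of `S` with their own weights. [cite: MochizukiGenEll2010, Prop. 1.7 (i) p. 9–10]
[cite: Mochizuki2012, IUTchIV Thm. 1.10 Step (ii) p. 24] [claim: Mochizuki2012, status: disputed] -/
theorem ndeg_differentDivisor_ge_weighted (S : Finset (HeightOneSpectrum (𝓞 P.F)))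
    (m : HeightOneSpectrum (𝓞 P.F) → ℕ) (hm : ∀ v ∈ S, 0 < m v)
    (hram : letI := T.instFieldF; letI := T.instNumberFieldF; letI := T.instAlgebraF; letI := T.instFieldK
      letI := T.instNumberFieldK; letI := T.instAlgebraK
      letI : Algebra P.F T.K := ((algebraMap T.F T.K).comp (algebraMap P.F T.F)).toAlgebra
      ∀ v ∈ S, ∀ w ∈ IsDedekindDomain.primesOverFinset v.asIdeal (𝓞 T.K), m v ≤ ramificationIdx' v.asIdeal w) :
    (letI := T.instFieldK; letI := T.instNumberFieldK
     P.logDiff + (P.degree : ℝ)⁻¹ * ∑ v ∈ S, (1 - (m v : ℝ)⁻¹) * Real.log (absNorm v.asIdeal : ℝ)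
      ≤ ndeg T.K (differentDivisor T.K)) := by
  classical
  letI := T.instFieldF; letI := T.instNumberFieldF; letI := T.instAlgebraF; letI := T.instFieldK
  letI := T.instNumberFieldK; letI := T.instAlgebraK
  letI : Algebra P.F T.K := ((algebraMap T.F T.K).comp (algebraMap P.F T.F)).toAlgebra
  -- the places of `K` over `S`
  set Tx : Finset (HeightOneSpectrum (𝓞 T.K)) := S.biUnion fun v =>
    (IsDedekindDomain.primesOverFinset v.asIdeal (𝓞 T.K)).preimage HeightOneSpectrum.asIdeal
      (fun _ _ _ _ h => HeightOneSpectrum.ext h) with hTx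
  have hT : ∀ w : HeightOneSpectrum (𝓞 T.K), w.under (𝓞 P.F) ∈ S → w ∈ Tx := by
    intro w hw
    rw [hTx, Finset.mem_biUnion]
    refine ⟨w.under (𝓞 P.F), hw, ?_⟩
    rw [Finset.mem_preimage, IsDedekindDomain.mem_primesOverFinset_iff (w.under (𝓞 P.F)).ne_bot]
    exact ⟨w.isPrime, ⟨rfl⟩⟩
  -- [GenEll] Prop. 1.7 (i)
  have hmain := cond_sub_cond_le_logdisc_sub_logdisc P.F T.K S Tx hT
  -- `Σ_{Tx} = Σ_{v∈S} Σ_{w∣v}`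
  have hTsum : ∑ w ∈ Tx, Real.log (absNorm w.asIdeal : ℝ) =
      ∑ v ∈ S, ∑ w ∈ IsDedekindDomain.primesOverFinset v.asIdeal (𝓞 T.K), Real.log (absNorm w : ℝ) := by
    rw [hTx, Finset.sum_biUnion]
    · refine Finset.sum_congr rfl fun v _ => ?_
      refine Finset.sum_preimage HeightOneSpectrum.asIdeal _ _
        (fun w : Ideal (𝓞 T.K) => Real.log (absNorm w : ℝ)) ?_
      intro w hw hnot
      exfalso
      rw [IsDedekindDomain.mem_primesOverFinset_iff v.ne_bot] at hw
      exact hnot ⟨⟨w, hw.1, Ideal.ne_bot_of_mem_primesOver v.ne_bot hw⟩, rfl⟩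
    · intro v _ v' _ hne
      refine Finset.disjoint_left.mpr fun w hw hw' => hne ?_
      dsimp only at hw hw'
      rw [Finset.mem_preimage, IsDedekindDomain.mem_primesOverFinset_iff v.ne_bot] at hw
      rw [Finset.mem_preimage, IsDedekindDomain.mem_primesOverFinset_iff v'.ne_bot] at hw'
      exact HeightOneSpectrum.ext (hw.2.over.trans hw'.2.over.symm)
  -- §1: the weighted bound on the places over `S`
  have hx : (finrank ℚ T.K : ℝ)⁻¹ * ∑ w ∈ Tx, Real.log (absNorm w.asIdeal : ℝ) ≤
      (finrank ℚ P.F : ℝ)⁻¹ * ∑ v ∈ S, ((m v : ℝ)⁻¹ * Real.log (absNorm v.asIdeal : ℝ)) := by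
    rw [hTsum]
    exact cond_above_le_cond_weighted P.F T.K S m hm hram
  -- dictionary of the remaining terms
  have hdP : P.logDiff = (P.degree : ℝ)⁻¹ * Real.log ((discr P.F).natAbs : ℝ) := NFPoint.logDiff_eq_log_discr P
  have hdK : ndeg T.K (differentDivisor T.K) = (finrank ℚ T.K : ℝ)⁻¹ * Real.log ((discr T.K).natAbs : ℝ) := by
    have h1 := logDiff_eq_ndeg_differentDivisor (extend P T.K)
    have h2 := NFPoint.logDiff_eq_log_discr (extend P T.K)
    rw [h1] at h2
    exact h2
  have hdeg : (P.degree : ℝ) = (finrank ℚ P.F : ℝ) := rfl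
  -- `Σ (1 − 1/m_v)·log N(v) = Σ log N(v) − Σ (1/m_v)·log N(v)`
  have hsplit : ∑ v ∈ S, (1 - (m v : ℝ)⁻¹) * Real.log (absNorm v.asIdeal : ℝ) =
      ∑ v ∈ S, Real.log (absNorm v.asIdeal : ℝ) - ∑ v ∈ S, ((m v : ℝ)⁻¹ * Real.log (absNorm v.asIdeal : ℝ)) := by
    rw [← Finset.sum_sub_distrib]
    exact Finset.sum_congr rfl fun v _ => by ring
  rw [hdP, hdK, hdeg, hsplit, mul_sub]
  linarith [hmain, hx]

/-- **THE WEIGHTED SUFFICIENT HALF OF THE (P)-LINE CRUX AT A DATUM**: `λ ∈ U_X`, `l ≥ 1`, `d_mod ≤ (l+5)/4`, `S` a finite set of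
places of `F_tpd` with weights `m_v ≥ 1`, `m_v ≤ e(w∣v)` for every place `w` of `K` over `v ∈ S`; if
`((l+1)/24 − 1/(2l))·log q^{∤2l}(λ) ≤ ((l+5)/4 − d_mod)·(log-diff(λ) + (1/[F_tpd:ℚ])·Σ_{v∈S} (1 − 1/m_v)·log N(v)) + ((l+5)/4)·log π`
then [IUTchIII] Cor. 3.12 holds IN READING (P) at `T` (this seat's gen-7 `GenuineContent.cor312PerImageOf_of_le_mul_ndeg` + the
weighted Step (ii) bound). [cite: Mochizuki2012, IUTchIII Cor. 3.12 p. 173–174] [cite: Mochizuki2012, IUTchIV Thm. 1.10 Step (ii) p. 24,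
Step (v) p. 27–29] [claim: Mochizuki2012, status: disputed] -/
theorem cor312PerImageOf_of_le_weighted (hU : P.InU) (hd : (dmod P : ℝ) ≤ ((l : ℝ) + 5) / 4)
    (S : Finset (HeightOneSpectrum (𝓞 P.F))) (m : HeightOneSpectrum (𝓞 P.F) → ℕ) (hm : ∀ v ∈ S, 0 < m v)
    (hram : letI := T.instFieldF; letI := T.instNumberFieldF; letI := T.instAlgebraF; letI := T.instFieldK
      letI := T.instNumberFieldK; letI := T.instAlgebraK
      letI : Algebra P.F T.K := ((algebraMap T.F T.K).comp (algebraMap P.F T.F)).toAlgebra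
      ∀ v ∈ S, ∀ w ∈ IsDedekindDomain.primesOverFinset v.asIdeal (𝓞 T.K), m v ≤ ramificationIdx' v.asIdeal w)
    (h : (((l : ℝ) + 1) / 24 - 1 / (2 * l)) * logQAvoid P {2, l} ≤
      (((l : ℝ) + 5) / 4 - dmod P) * (P.logDiff
          + (P.degree : ℝ)⁻¹ * ∑ v ∈ S, (1 - (m v : ℝ)⁻¹) * Real.log (absNorm v.asIdeal : ℝ))
        + ThetaVolumeInput.archLogTheta l) :
    T.Cor312PerImageOf := by
  letI := T.instFieldF; letI := T.instNumberFieldF; letI := T.instAlgebraF; letI := T.instFieldK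
  letI := T.instNumberFieldK; letI := T.instAlgebraK; letI := T.instFieldFbar; letI := T.instAlgebraFbar
  letI := T.instAlgebraKFbar; letI := T.instIsElliptic
  haveI := T.isGalois_fieldOfModuli_K
  have hgap := PointDict.gap_eq T hU
  have hXlN : T.I.X.l = l := T.isVolumeInputOf.l_eq
  have hXl : ((T.I.X.l : ℕ) : ℝ) = (l : ℝ) := by exact_mod_cast hXlN
  have hls : ((T.I.X.lstar : ℝ) + 3) / 2 = ((l : ℝ) + 5) / 4 := by
    have h2 : T.I.X.l = 2 * T.I.X.lstar + 1 := T.I.X.l_eq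
    have h2R : ((T.I.X.l : ℕ) : ℝ) = 2 * (T.I.X.lstar : ℝ) + 1 := by exact_mod_cast h2
    rw [hXl] at h2R
    linarith
  have hdm : (Module.finrank ℚ (fieldOfModuli T.E) : ℝ) = (dmod P : ℝ) := by
    exact_mod_cast PointStepV.finrank_fieldOfModuli_eq_dmod T
  -- the weighted Step (ii) bound at the datum
  have hdiff := T.ndeg_differentDivisor_ge_weighted S m hm hram
  have hc : 0 ≤ ((l : ℝ) + 5) / 4 - (dmod P : ℝ) := by linarith
  have hmono := mul_le_mul_of_nonneg_left hdiff hc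
  show T.I.Cor312PerImageOf
  refine GenuineContent.cor312PerImageOf_of_le_mul_ndeg T.I ?_
  rw [hXl, hls, hdm]
  have hg : T.gap = (((l : ℝ) + 1) / 24 - 1 / (2 * l)) * FinDivisor.ndeg (fieldOfModuli T.E) T.I.X.qDivisor := by
    show LgpDivisor.ndegLgp T.I.X.thetaPilot - FinDivisor.ndeg _ T.I.X.qPilot = _
    rw [DHData.ndegLgp_thetaPilot_eq, PilotData.qPilot_eq_smul, map_smul, smul_eq_mul, hXl]
    ring
  rw [← hg, hgap]
  show _ ≤ _ + ThetaVolumeInput.archLogTheta T.I.X.l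
  rw [hXlN]
  change P.logDiff + (P.degree : ℝ)⁻¹ * ∑ v ∈ S, (1 - (m v : ℝ)⁻¹) * Real.log (absNorm v.asIdeal : ℝ)
    ≤ ndeg T.K (differentDivisor T.K) at hdiff
  linarith

end ThetaVolumeDatumAt

end Literature.IUT.LogVolume.Cor22

end
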